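import Summits.QuantumFields.BalabanUV.Beta.FP.StepLawFromRows
import Summits.QuantumFields.BalabanUV.Beta.FP.RoadFromSlots
import Summits.QuantumFields.BalabanUV.Beta.GAN24.RealRateKMHolds

/-!
# `BalabanUV.Beta.FP.StepLawKHolds` — road «FP» for binder row D1: EVERY K-SIDE BINDER OF THE PERFECT FAMILY's STEP LAW AND OF THE ROAD's END
# DISCHARGED FOR EVERY `m ≥ 1` (`d = 3`, every `Lc ≥ 2`, adopted units `(sfStep Lc, smStep 3 Lc)`), BY REBASE — no new estimate

Leaf-02's (STEP) socket `StepLawAssembly.fPerf_succ_of_fubini(_flip)` and this lineage's `StepLawFromRows.fPerf_succ_of_rows` carry, for every `m`, the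
X1m-K data of the rescaled (j, m)-resolvents — a `j`-uniform `Decays` bound `hK`, the all-scales `Decays`-currency deviations `hKall` with `θ m < 1`, the
sign data `hC`/`hδK` — and, in class currency, `Decays (KPerf … m)` (`hKinf`, `hδK'`).  They enter through ONE door: the admissibility
`EntryHyps (Lc^m) (colOf (KPerf … m)) 𝒯` of the perfect `m`-fold transport column against the perfect one-step kernel (`TransportInfinityM.entryHyps_perfCol`),
plus `Decays (KPerf … m)` for the (5.10)-decay / AbsMoment₂ of the perfect triples.  Both are now UNCONDITIONAL:
* gan24-p3-g13's `GAN24.RealRateKMHolds` (p216285) proves X1m-K for every `m ≥ 1` and, through `FP.PerfectRebase`, the REBASE IDENTITY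
  `KPerf Lc (sfStep Lc) (smStep 3 Lc) m = KPerf (Lc^m) (sfStep (Lc^m)) (smStep 3 (Lc^m)) 1` (`KPerf_eq_KPerf_pow_base_holds`) and the kernel-side class data
  `kernelSide_KPerf_holds` (decay, `Lc^m`-block covariance, reflection invariance);
* this lineage's `FP.KSlotHolds.entryHyps_perfCol_one_holds` gives the `m = 1` admissibility at EVERY base `Lc ≥ 2` from gan24's `convCKWall_holds` — in
  particular at base `Lc^m` (`PerfectRebase.two_le_pow`).
Rewriting the perfect `m`-fold resolvent as the perfect one-step resolvent at base `Lc^m` therefore discharges the door for every `m` (§1), and with it the seven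
K-side binders of the STEP socket (§2 generic currency, §3 class currency, §4 fed by the wall's rows) and of the road's END / the cell's END (§5).

HONEST FRAMING (cell contract, verbatim): «discharging `BetaPertH` makes Bałaban's UV stability UNCONDITIONAL — a real constructive-QFT result; it is NOT the
continuum limit and NOT the Clay problem.»  THIS MODULE DISCHARGES ONLY THE K-SIDE (resolvent) BINDERS.  REMAINING HYPOTHESES, all displayed: the S- and W-slot
Cauchy rows of row G-an2-4 and the `m = 1` pins; the finite-`j` symmetry rows `hRj` (an2's hR) / `hWj` (an1's hW) — two of the four binders of
`OneStepKernelFamily.d1Drift_of_D1Tel_D1Rep`; the limit-currency class data of the perfect stencils / tables for `m ≥ 2` (the (j, m) jet families `S`, `Wt` are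
free parameters there); the fixed-point Fubini identity with remainder `hfub` + `hDA` (leaf N2a), (SDF)∞ `hSDF` (leaf N2b); the leading-log asymptotics `hasym`
(leaf N7); for the cell END also hβ, (D4), (C), hgen.  HEADLINE: «road FP's (STEP) socket and END are K-side unconditional for every m» — NOT «(STEP) proved»,
NOT «D1 closed», NOT «G-an2-4 closed», NOT BetaPertH, NOT continuum, NOT Clay; 0 wall binders instantiated at a value.  Claim table
`HOME/b2b-balaban-beta-d1-p3/LEAVES-FP.md` sub-row STEP-K-HOLDS (unit `b2b-balaban-beta-d1-formalise-leaf-06`, gen 3); disjoint from gan24-p3-g14's «KSLOT-M»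
(which proves the `Decays`-currency rows `hK`/`hKall` themselves — a second inhabitant of §1 through `entryHyps_perfCol` once it lands).
HONEST DEPENDENCY (verbatim): «continuum YM on T⁴ ⇐ BetaPertH ∧ nine spine estimates (0/9 proved); BetaPertH ⇐ (D1) ∧ (D4) ∧ CAP+tail; G-an2-4 gates asym,
D1 and NE2/3/4.»
ABSOLUTE RULE (cell, verbatim): «No internally-minted statement may enter as a cited fact. Every hypothesis is either kernel-proved in this package or a verbatim
quotation of a PUBLISHED theorem with page reference.»  Nothing is cited; no `def`; every input is a tree theorem imported BY NAME; nothing of leaf-02's,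
gan24-p3's or `RoadFromSlots`' is restated — each theorem below is a composition over them.
-/

namespace Summit.QuantumFields.BalabanUV.Beta.FP.StepLawKHolds

open Filter Topology
open Literature.MathematicalPhysics.QuantumFieldTheory
open Literature.MathematicalPhysics.QuantumFieldTheory.Balaban1983to89
open Literature.MathematicalPhysics.QuantumFieldTheory.Balaban1983to89.Beta
open B12Beta (secondMoment)
open B12Normalization (stepBal)
open DecimatedMomentSummable (AbsMoment₂)
open DressedMomentNormalisation (EKer m2Tensor coarseTensor dressedEntry EntryHyps coarseTensor_eq_m2Tensor)
open ExpKernelCalculus (MKer Decays VertexFamily₂)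
open PolarizationSign (WardTransversal AxisReflectionCovariant)
open OneStepResolventKernel (Fib LocStencil)
open OneStepKernelFamily (KInvStep TbalOf flipK D1Drift)
open BalabanStepJetsSucc (JsBal0Of JsBalOf)
open HessianTelescopingKKT (hasSum_transport_m2Tensor)
open FlowStep FlowStepRuns DagBinding
open RemainderChain (RemainderConst)
open Summit.QuantumFields.BalabanUV.Beta.HessKerDressedUnits (unitK unitS unitW)
open Summit.QuantumFields.BalabanUV.Beta.GAN24.CombesThomas (sfStep smStep)
open Summit.QuantumFields.BalabanUV.Beta.GAN24.RealRateKMHolds (KPerf_eq_KPerf_pow_base_holds kernelSide_KPerf_holds)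
open Summit.QuantumFields.BalabanUV.Beta.FP.PerfectRebase (two_le_pow)
open Summit.QuantumFields.BalabanUV.Beta.FP.PerfectObjectsT (KPerf SPerfOf WPerfOf TPerfOf fPerf fPerf_def)
open Summit.QuantumFields.BalabanUV.Beta.FP.TransportInfinityM (colOf)
open Summit.QuantumFields.BalabanUV.Beta.FP.KSlotHolds (entryHyps_perfCol_one_holds)
open Summit.QuantumFields.BalabanUV.Beta.FP.StepLawAssembly (secondMoment_succ_of_fubini hdec_TPerfOf absMoment₂_TPerfOf wardData_of_printed_flip)
open Summit.QuantumFields.BalabanUV.Beta.FP.SymmetryInheritHolds (axisReflectionCovariant_flipK_TPerfOf_one_holdsK wardTransversal_flipK_TPerfOf_one_holdsK)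
open Summit.QuantumFields.BalabanUV.Beta.FP.RoadFromSlots (exists_limit_rows_of_slots d1Drift_JsBalOf_of_slots_step_law_bounded
  d1Drift_JsBalOf_of_slots_step_law_littleO endpointExistence_of_slots_step_law_bounded)

noncomputable section

variable {Lc : ℕ} [NeZero Lc]

/-! ## §1 The perfect `m`-fold transport column is admissible for EVERY `m` — K-side unconditional (N5b-2 ∀ m) -/

/-- **THE PERFECT `m`-FOLD RESOLVENT's COLUMN IS AN ADMISSIBLE TRANSPORT WEIGHT AT BLOCKING `Lc^m`, FOR EVERY `m ≥ 1`** (`d = 3`, `2 ≤ Lc`, adopted units):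
for ANY kernel `𝒯 : EKer 4` with absolutely summable second moments and vanishing zeroth/first moments,
`EntryHyps (Lc^m) (colOf (KPerf Lc (sfStep Lc) (smStep 3 Lc) m)) 𝒯` — the `hadm` door of leaf-02's abstract socket `StepLawAssembly.secondMoment_succ_of_fubini`.
PROOF = REBASE: `KPerf … m = KPerf (Lc^m) … 1` (`RealRateKMHolds.KPerf_eq_KPerf_pow_base_holds`) and `KSlotHolds.entryHyps_perfCol_one_holds` at base `Lc^m`
(`2 ≤ Lc^m` by `PerfectRebase.two_le_pow`).  No estimate is proved here. [our object] -/
theorem entryHyps_perfCol_holds (hLc : 2 ≤ Lc) {m : ℕ} (hm : 1 ≤ m) {𝒯 : EKer 4} (hT : ∀ c e, AbsMoment₂ (𝒯 c e))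
    (hT0 : ∀ c e, HasSum (𝒯 c e) 0) (hT1 : ∀ c e (μ : Fin 4), HasSum (fun t => t μ • 𝒯 c e t) 0) :
    EntryHyps (Lc ^ m) (colOf (KPerf (d := 3) Lc (sfStep Lc) (smStep 3 Lc) m)) 𝒯 := by
  rw [KPerf_eq_KPerf_pow_base_holds hLc hm]
  exact entryHyps_perfCol_one_holds (Lc := Lc ^ m) (two_le_pow hLc hm) hT hT0 hT1

/-- **TRANSPORT INVARIANCE THROUGH THE PERFECT `m`-FOLD MINIMISER, `HasSum` form, EVERY `m ≥ 1`** (an4's `hasSum_transport_m2Tensor` shape): the second-moment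
tensor of `(Lc^m)^8 · dressedEntry (colOf (KPerf … m)) 𝒯 (Lc^m • ·)` IS `m2Tensor 𝒯`. [our object] -/
theorem hasSum_transport_m2Tensor_perfCol_holds (hLc : 2 ≤ Lc) {m : ℕ} (hm : 1 ≤ m) {𝒯 : EKer 4} (hT : ∀ c e, AbsMoment₂ (𝒯 c e))
    (hT0 : ∀ c e, HasSum (𝒯 c e) 0) (hT1 : ∀ c e (μ : Fin 4), HasSum (fun t => t μ • 𝒯 c e t) 0) (κ lam a b : Fin 4) :
    HasSum (fun z : Fin 4 → ℤ => (z κ * z lam) •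
        ((((Lc ^ m : ℕ) : ℝ)) ^ 8 * dressedEntry (colOf (KPerf (d := 3) Lc (sfStep Lc) (smStep 3 Lc) m)) 𝒯 (((Lc ^ m : ℕ) : ℤ) • z) a b))
      (m2Tensor 𝒯 κ lam a b) :=
  hasSum_transport_m2Tensor (entryHyps_perfCol_holds hLc hm hT hT0 hT1) κ lam a b

/-- **β IS INVARIANT UNDER TRANSPORT THROUGH THE PERFECT `m`-FOLD MINIMISER, EVERY `m ≥ 1`** (`coarseTensor (Lc^m) (colOf (KPerf … m)) 𝒯 = m2Tensor 𝒯`) — the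
d = 4 marginality at the fixed point, K-side unconditional; the Ward data of `𝒯` remain hypotheses. [our object] -/
theorem coarseTensor_perfCol_eq_m2Tensor_holds (hLc : 2 ≤ Lc) {m : ℕ} (hm : 1 ≤ m) {𝒯 : EKer 4} (hT : ∀ c e, AbsMoment₂ (𝒯 c e))
    (hT0 : ∀ c e, HasSum (𝒯 c e) 0) (hT1 : ∀ c e (μ : Fin 4), HasSum (fun t => t μ • 𝒯 c e t) 0) :
    coarseTensor (Lc ^ m) (colOf (KPerf (d := 3) Lc (sfStep Lc) (smStep 3 Lc) m)) 𝒯 = m2Tensor 𝒯 :=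
  coarseTensor_eq_m2Tensor (entryHyps_perfCol_holds hLc hm hT hT0 hT1)

/-- **THE PERFECT `m`-FOLD RESOLVENT DECAYS, EVERY `m ≥ 1`** — the `hKinf` binder of the class-currency sockets, with SOME constant and rate
(`RealRateKMHolds.kernelSide_KPerf_holds`, first component). [our object] -/
theorem exists_decays_KPerf_holds (hLc : 2 ≤ Lc) {m : ℕ} (hm : 1 ≤ m) :
    ∃ C δ : ℝ, 0 < δ ∧ Decays (KPerf (d := 3) Lc (sfStep Lc) (smStep 3 Lc) m) C δ := by
  obtain ⟨δ₀, C₀, hδ₀, -, hK⟩ := (kernelSide_KPerf_holds hLc hm).1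
  exact ⟨C₀, δ₀, hδ₀, hK⟩

/-! ## §2 The (STEP) socket with the X1m-K binders gone (generic currency) -/

section Perfect

variable (S : ℕ → ℕ → Fin (3 + 1) → (Fin (3 + 1) → ℤ) → MKer (3 + 1) (Fib 3))
  (Wt : ℕ → ℕ → Fin (3 + 1) → (Fin (3 + 1) → ℤ) → Fin (3 + 1) → (Fin (3 + 1) → ℤ) → MKer (3 + 1) (Fib 3))
  {D : ℕ → EKer 4}

/-- **THE STEP LAW OF THE PERFECT COEFFICIENT FAMILY FROM THE N2 INPUTS, X1m-K DISCHARGED** (`d = 3`, `2 ≤ Lc`, adopted units): leaf-02's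
`StepLawAssembly.fPerf_succ_of_fubini` with its five X1m-K binders `hC`/`hδK`/`hK`/`hKall`/`hθ1` (and the bond-unit pin `hunit`) GONE — the admissibility door
`hadm` of the abstract socket `secondMoment_succ_of_fubini` is §1's `entryHyps_perfCol_holds`.  REMAINING (displayed): Ward data (T0)/(T1)/AbsMoment₂ of the
perfect ONE-step kernel, AbsMoment₂ of the `m`-fold kernels and of the defect `D m`, the fixed-point Fubini identity with remainder (N2a + N1), (SDF)∞ (N2b).
CONCLUSION: `∀ m ≥ 1, fPerf … (m+1) = fPerf … m + fPerf … 1` — LITERALLY the `hstep` of `RoadFromSlots.d1Drift_JsBalOf_of_slots_step_law_bounded`. [our object] -/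
theorem fPerf_succ_of_fubini_holdsK (hLc : 2 ≤ Lc)
    (hT : ∀ a b, AbsMoment₂ (TPerfOf Lc (KPerf Lc (sfStep Lc) (smStep 3 Lc) 1) (SPerfOf (sfStep Lc) (smStep 3 Lc) S 1)
      (WPerfOf (sfStep Lc) (smStep 3 Lc) Wt 1) a b))
    (hT0 : ∀ a b, HasSum (TPerfOf Lc (KPerf Lc (sfStep Lc) (smStep 3 Lc) 1) (SPerfOf (sfStep Lc) (smStep 3 Lc) S 1)
      (WPerfOf (sfStep Lc) (smStep 3 Lc) Wt 1) a b) 0)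
    (hT1 : ∀ a b (μ' : Fin 4), HasSum (fun t => t μ' • TPerfOf Lc (KPerf Lc (sfStep Lc) (smStep 3 Lc) 1) (SPerfOf (sfStep Lc) (smStep 3 Lc) S 1)
      (WPerfOf (sfStep Lc) (smStep 3 Lc) Wt 1) a b t) 0)
    (hA : ∀ m : ℕ, 1 ≤ m → ∀ a b, AbsMoment₂ (TPerfOf (Lc ^ m) (KPerf Lc (sfStep Lc) (smStep 3 Lc) m) (SPerfOf (sfStep Lc) (smStep 3 Lc) S m)
      (WPerfOf (sfStep Lc) (smStep 3 Lc) Wt m) a b))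
    (hDA : ∀ m : ℕ, 1 ≤ m → ∀ a b, AbsMoment₂ (D m a b))
    (hfub : ∀ m : ℕ, 1 ≤ m → ∀ (a b : Fin 4) (z : Fin 4 → ℤ),
      TPerfOf (Lc ^ (m + 1)) (KPerf Lc (sfStep Lc) (smStep 3 Lc) (m + 1)) (SPerfOf (sfStep Lc) (smStep 3 Lc) S (m + 1))
          (WPerfOf (sfStep Lc) (smStep 3 Lc) Wt (m + 1)) a b z
        = ((Lc ^ m : ℕ) : ℝ) ^ 8 * dressedEntry (colOf (KPerf (d := 3) Lc (sfStep Lc) (smStep 3 Lc) m))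
            (TPerfOf Lc (KPerf Lc (sfStep Lc) (smStep 3 Lc) 1) (SPerfOf (sfStep Lc) (smStep 3 Lc) S 1) (WPerfOf (sfStep Lc) (smStep 3 Lc) Wt 1))
            (((Lc ^ m : ℕ) : ℤ) • z) a b
          + TPerfOf (Lc ^ m) (KPerf Lc (sfStep Lc) (smStep 3 Lc) m) (SPerfOf (sfStep Lc) (smStep 3 Lc) S m) (WPerfOf (sfStep Lc) (smStep 3 Lc) Wt m) a b z
          + D m a b z)
    (μ ν : Fin 4) (hSDF : ∀ m : ℕ, 1 ≤ m → secondMoment (D m) μ ν = 0) :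
    ∀ m : ℕ, 1 ≤ m → fPerf Lc (sfStep Lc) (smStep 3 Lc) S Wt μ ν (m + 1) =
      fPerf Lc (sfStep Lc) (smStep 3 Lc) S Wt μ ν m + fPerf Lc (sfStep Lc) (smStep 3 Lc) S Wt μ ν 1 := by
  -- the perfect family as an `ℕ → EKer 4` (leaf-02's bookkeeping, verbatim up to the door `hadm`)
  set TP : ℕ → EKer 4 := fun m => TPerfOf (Lc ^ m) (KPerf Lc (sfStep Lc) (smStep 3 Lc) m) (SPerfOf (sfStep Lc) (smStep 3 Lc) S m)
    (WPerfOf (sfStep Lc) (smStep 3 Lc) Wt m) with hTP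
  have hTP1 : TP 1 = TPerfOf Lc (KPerf Lc (sfStep Lc) (smStep 3 Lc) 1) (SPerfOf (sfStep Lc) (smStep 3 Lc) S 1)
      (WPerfOf (sfStep Lc) (smStep 3 Lc) Wt 1) := by
    simp only [hTP, pow_one]
  have hadm : ∀ m : ℕ, 1 ≤ m → EntryHyps (Lc ^ m) (colOf (KPerf (d := 3) Lc (sfStep Lc) (smStep 3 Lc) m)) (TP 1) := fun m hm => by
    rw [hTP1]
    exact entryHyps_perfCol_holds hLc hm hT hT0 hT1
  have hfub' : ∀ m : ℕ, 1 ≤ m → ∀ (a b : Fin 4) (z : Fin 4 → ℤ),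
      TP (m + 1) a b z = ((Lc ^ m : ℕ) : ℝ) ^ 8 * dressedEntry (colOf (KPerf (d := 3) Lc (sfStep Lc) (smStep 3 Lc) m)) (TP 1)
        (((Lc ^ m : ℕ) : ℤ) • z) a b + TP m a b z + D m a b z := fun m hm a b z => by
    rw [hTP1]; exact hfub m hm a b z
  have h := secondMoment_succ_of_fubini (TP := TP) (w := fun m => colOf (KPerf (d := 3) Lc (sfStep Lc) (smStep 3 Lc) m)) (N := fun m => Lc ^ m)
    hfub' hadm (fun m hm => hA m hm) hDA μ ν hSDF
  intro m hm
  have hm' := h m hm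
  rw [hTP1] at hm'
  simpa only [fPerf_def, TPerfOf, hTP, pow_one] using hm'

/-! ## §3 The (STEP) socket in class currency, K-side gone -/

/-- **THE STEP LAW IN CLASS CURRENCY, K-SIDE UNCONDITIONAL** (`d = 3`, `2 ≤ Lc`, adopted units): leaf-02's `StepLawAssembly.fPerf_succ_of_fubini_flip` with the
five X1m-K binders AND the perfect resolvents' class data `hKinf`/`hδK'` GONE (§1 + `RealRateKMHolds.kernelSide_KPerf_holds`).  REMAINING (displayed): the
limit-currency class data of the perfect stencils `SPerfOf … S m` and tables `WPerfOf … Wt m` for every `m ≥ 1` (existential constants), the PRINTED LAWS of the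
flipped perfect one-step kernel (`WardTransversal` / `AxisReflectionCovariant` of `flipK (TPerf 1)` — leaf N3), the Fubini∞ identity `hfub` + `hDA` (N2a), (SDF)∞
`hSDF` (N2b). [our object] -/
theorem fPerf_succ_of_fubini_flip_holdsK (hLc : 2 ≤ Lc)
    (hSinf : ∀ m : ℕ, 1 ≤ m → ∃ Cs δS : ℝ, 0 < δS ∧ LocStencil (SPerfOf (sfStep Lc) (smStep 3 Lc) S m) Cs δS)
    (hWinf : ∀ m : ℕ, 1 ≤ m → ∃ Cw δW : ℝ, 0 < δW ∧ VertexFamily₂ (WPerfOf (sfStep Lc) (smStep 3 Lc) Wt m) (Lc ^ m) Cw δW)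
    (hWf : WardTransversal (flipK (TPerfOf Lc (KPerf Lc (sfStep Lc) (smStep 3 Lc) 1) (SPerfOf (sfStep Lc) (smStep 3 Lc) S 1)
      (WPerfOf (sfStep Lc) (smStep 3 Lc) Wt 1))))
    (hRf : AxisReflectionCovariant (flipK (TPerfOf Lc (KPerf Lc (sfStep Lc) (smStep 3 Lc) 1) (SPerfOf (sfStep Lc) (smStep 3 Lc) S 1)
      (WPerfOf (sfStep Lc) (smStep 3 Lc) Wt 1))))
    (hDA : ∀ m : ℕ, 1 ≤ m → ∀ a b, AbsMoment₂ (D m a b))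
    (hfub : ∀ m : ℕ, 1 ≤ m → ∀ (a b : Fin 4) (z : Fin 4 → ℤ),
      TPerfOf (Lc ^ (m + 1)) (KPerf Lc (sfStep Lc) (smStep 3 Lc) (m + 1)) (SPerfOf (sfStep Lc) (smStep 3 Lc) S (m + 1))
          (WPerfOf (sfStep Lc) (smStep 3 Lc) Wt (m + 1)) a b z
        = ((Lc ^ m : ℕ) : ℝ) ^ 8 * dressedEntry (colOf (KPerf (d := 3) Lc (sfStep Lc) (smStep 3 Lc) m))
            (TPerfOf Lc (KPerf Lc (sfStep Lc) (smStep 3 Lc) 1) (SPerfOf (sfStep Lc) (smStep 3 Lc) S 1) (WPerfOf (sfStep Lc) (smStep 3 Lc) Wt 1))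
            (((Lc ^ m : ℕ) : ℤ) • z) a b
          + TPerfOf (Lc ^ m) (KPerf Lc (sfStep Lc) (smStep 3 Lc) m) (SPerfOf (sfStep Lc) (smStep 3 Lc) S m) (WPerfOf (sfStep Lc) (smStep 3 Lc) Wt m) a b z
          + D m a b z)
    (μ ν : Fin 4) (hSDF : ∀ m : ℕ, 1 ≤ m → secondMoment (D m) μ ν = 0) :
    ∀ m : ℕ, 1 ≤ m → fPerf Lc (sfStep Lc) (smStep 3 Lc) S Wt μ ν (m + 1) =
      fPerf Lc (sfStep Lc) (smStep 3 Lc) S Wt μ ν m + fPerf Lc (sfStep Lc) (smStep 3 Lc) S Wt μ ν 1 := by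
  -- class data at `m = 1`, blocking `Lc ^ 1 = Lc`; the resolvent's from `kernelSide_KPerf_holds`
  obtain ⟨CK1, δK1, hδK1, hK1⟩ := exists_decays_KPerf_holds hLc (m := 1) le_rfl
  obtain ⟨Cs1, δS1, hδS1, hS1⟩ := hSinf 1 le_rfl
  obtain ⟨Cw1, δW1, hδW1, hW1'⟩ := hWinf 1 le_rfl
  have hW1 : VertexFamily₂ (WPerfOf (sfStep Lc) (smStep 3 Lc) Wt 1) Lc Cw1 δW1 := by simpa only [pow_one] using hW1'
  have hdec1 := hdec_TPerfOf (n := Lc) hK1 hδK1 hS1 hδS1 hW1 hδW1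
  obtain ⟨hT0, hT1⟩ := wardData_of_printed_flip hdec1 hWf hRf
  have hT : ∀ a b, AbsMoment₂ (TPerfOf Lc (KPerf Lc (sfStep Lc) (smStep 3 Lc) 1) (SPerfOf (sfStep Lc) (smStep 3 Lc) S 1)
      (WPerfOf (sfStep Lc) (smStep 3 Lc) Wt 1) a b) :=
    absMoment₂_TPerfOf (n := Lc) hK1 hδK1 hS1 hδS1 hW1 hδW1
  have hA : ∀ m : ℕ, 1 ≤ m → ∀ a b, AbsMoment₂ (TPerfOf (Lc ^ m) (KPerf Lc (sfStep Lc) (smStep 3 Lc) m) (SPerfOf (sfStep Lc) (smStep 3 Lc) S m)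
      (WPerfOf (sfStep Lc) (smStep 3 Lc) Wt m) a b) := fun m hm => by
    obtain ⟨CKm, δKm, hδKm, hKm⟩ := exists_decays_KPerf_holds hLc hm
    obtain ⟨Csm, δSm, hδSm, hSm⟩ := hSinf m hm
    obtain ⟨Cwm, δWm, hδWm, hWm⟩ := hWinf m hm
    exact absMoment₂_TPerfOf (n := Lc ^ m) hKm hδKm hSm hδSm hWm hδWm
  exact fPerf_succ_of_fubini_holdsK S Wt hLc hT hT0 hT1 hA hDA hfub μ ν hSDF

end Perfect

/-! ## §4 The (STEP) socket fed by the wall's rows, K-side gone -/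

section Rows

variable (hLc : 1 ≤ Lc) (cE cVH cΛ : ℝ)
  (W : ℕ → Fin (3 + 1) → (Fin (3 + 1) → ℤ) → Fin (3 + 1) → (Fin (3 + 1) → ℤ) → MKer (3 + 1) (Fib 3))
  (Cw' δw : ℕ → ℝ) (hδw : ∀ j, 0 < δw j) (hW' : ∀ j, VertexFamily₂ (W j) Lc (Cw' j) (δw j))
  (S : ℕ → ℕ → Fin (3 + 1) → (Fin (3 + 1) → ℤ) → MKer (3 + 1) (Fib 3))
  (Wt : ℕ → ℕ → Fin (3 + 1) → (Fin (3 + 1) → ℤ) → Fin (3 + 1) → (Fin (3 + 1) → ℤ) → MKer (3 + 1) (Fib 3))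
  {Cs cS δS θS Cw cW δW θW : ℝ} {D : ℕ → EKer 4}

/-- **THE STEP LAW OF THE PERFECT COEFFICIENT FAMILY FROM THE WALL's ROWS, K-SIDE UNCONDITIONAL** (`d = 3`, `2 ≤ Lc`, adopted units): this lineage's
`StepLawFromRows.fPerf_succ_of_rows` with ALL SEVEN K-side binders (`hC`, `hδK`, `hK`, `hKall`, `hθ1`, `hKinf`, `hδK'`) GONE, and the `m = 1` class data of the
perfect stencil / tables read off the slot rows (`RoadFromSlots.exists_limit_rows_of_slots`) — so the limit-currency class data are asked only for `m ≥ 2`.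
REMAINING (displayed): the `m = 1` pins and the S- and W-slot Cauchy rows (row G-an2-4); the finite-`j` rows `hRj` (an2's hR) / `hWj` (an1's hW); class data of
`SPerfOf … S m` / `WPerfOf … Wt m` for `m ≥ 2`; Fubini∞ `hfub` + `hDA` (N2a); (SDF)∞ `hSDF` (N2b).  CONCLUSION: the END's `hstep`. [our object] -/
theorem fPerf_succ_of_rows_holdsK (hLc2 : 2 ≤ Lc)
    -- the `m = 1` pins and the S- and W-slot Cauchy rows (row G-an2-4, adopted units)
    (hS1 : ∀ j, S j 1 = (JsBal0Of hLc cE cVH cΛ W Cw' δw hδw hW' j).S) (hW1 : ∀ j, Wt j 1 = W j)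
    (hS : ∀ j, LocStencil (unitS (sfStep Lc j) (smStep 3 Lc j) (JsBal0Of hLc cE cVH cΛ W Cw' δw hδw hW' j).S) Cs δS)
    (hSall : ∀ k j, LocStencil (unitS (sfStep Lc (k + j)) (smStep 3 Lc (k + j)) (JsBal0Of hLc cE cVH cΛ W Cw' δw hδw hW' (k + j)).S -
      unitS (sfStep Lc k) (smStep 3 Lc k) (JsBal0Of hLc cE cVH cΛ W Cw' δw hδw hW' k).S) (cS * θS ^ k) δS)
    (hW : ∀ j, VertexFamily₂ (unitW (sfStep Lc j) (smStep 3 Lc j) (W j)) Lc Cw δW)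
    (hWall : ∀ k j, VertexFamily₂ (unitW (sfStep Lc (k + j)) (smStep 3 Lc (k + j)) (W (k + j)) - unitW (sfStep Lc k) (smStep 3 Lc k) (W k)) Lc
      (cW * θW ^ k) δW)
    (hδS : 0 < δS) (hδW : 0 < δW) (hθS0 : 0 ≤ θS) (hθS1 : θS < 1) (hθW0 : 0 ≤ θW) (hθW1 : θW < 1)
    -- the finite-`j` symmetry rows of the wall family (an2's hR, an1's hW)
    (hRj : ∀ j, AxisReflectionCovariant (flipK (TbalOf Lc (JsBalOf hLc cE cVH cΛ W Cw' δw hδw hW') j)))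
    (hWj : ∀ j, WardTransversal (flipK (TbalOf Lc (JsBalOf hLc cE cVH cΛ W Cw' δw hδw hW') j)))
    -- the limit-currency class data of the perfect stencils / tables for `m ≥ 2` (the (j, m) jet families are free there)
    (hSinf : ∀ m : ℕ, 2 ≤ m → ∃ Cs' δS' : ℝ, 0 < δS' ∧ LocStencil (SPerfOf (sfStep Lc) (smStep 3 Lc) S m) Cs' δS')
    (hWinf : ∀ m : ℕ, 2 ≤ m → ∃ Cw'' δW' : ℝ, 0 < δW' ∧ VertexFamily₂ (WPerfOf (sfStep Lc) (smStep 3 Lc) Wt m) (Lc ^ m) Cw'' δW')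
    -- N2a (Fubini∞ with remainder `D`), N2b ((SDF)∞)
    (hDA : ∀ m : ℕ, 1 ≤ m → ∀ a b, AbsMoment₂ (D m a b))
    (hfub : ∀ m : ℕ, 1 ≤ m → ∀ (a b : Fin 4) (z : Fin 4 → ℤ),
      TPerfOf (Lc ^ (m + 1)) (KPerf Lc (sfStep Lc) (smStep 3 Lc) (m + 1)) (SPerfOf (sfStep Lc) (smStep 3 Lc) S (m + 1))
          (WPerfOf (sfStep Lc) (smStep 3 Lc) Wt (m + 1)) a b z
        = ((Lc ^ m : ℕ) : ℝ) ^ 8 * dressedEntry (colOf (KPerf (d := 3) Lc (sfStep Lc) (smStep 3 Lc) m))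
            (TPerfOf Lc (KPerf Lc (sfStep Lc) (smStep 3 Lc) 1) (SPerfOf (sfStep Lc) (smStep 3 Lc) S 1) (WPerfOf (sfStep Lc) (smStep 3 Lc) Wt 1))
            (((Lc ^ m : ℕ) : ℤ) • z) a b
          + TPerfOf (Lc ^ m) (KPerf Lc (sfStep Lc) (smStep 3 Lc) m) (SPerfOf (sfStep Lc) (smStep 3 Lc) S m) (WPerfOf (sfStep Lc) (smStep 3 Lc) Wt m) a b z
          + D m a b z)
    (μ ν : Fin 4) (hSDF : ∀ m : ℕ, 1 ≤ m → secondMoment (D m) μ ν = 0) :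
    ∀ m : ℕ, 1 ≤ m → fPerf Lc (sfStep Lc) (smStep 3 Lc) S Wt μ ν (m + 1) =
      fPerf Lc (sfStep Lc) (smStep 3 Lc) S Wt μ ν m + fPerf Lc (sfStep Lc) (smStep 3 Lc) S Wt μ ν 1 := by
  -- the `m = 1` class data of the perfect stencil / tables from the slot rows
  obtain ⟨C, δK, cK, θ, R, hR, hRK, hRS, hRW, hθ0, hθ1, -, -, -, hSinf1, -, hWinf1, -⟩ :=
    exists_limit_rows_of_slots hLc cE cVH cΛ W Cw' δw hδw hW' S Wt hLc2 hS1 hW1 hS hSall hW hWall hδS hδW hθS0 hθS1 hθW0 hθW1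
  have hSinf' : ∀ m : ℕ, 1 ≤ m → ∃ Cs' δS' : ℝ, 0 < δS' ∧ LocStencil (SPerfOf (sfStep Lc) (smStep 3 Lc) S m) Cs' δS' := fun m hm => by
    rcases Nat.eq_or_lt_of_le hm with h1 | h2
    · exact ⟨Cs, δS, hδS, h1 ▸ hSinf1⟩
    · exact hSinf m h2
  have hWinf' : ∀ m : ℕ, 1 ≤ m → ∃ Cw'' δW' : ℝ, 0 < δW' ∧ VertexFamily₂ (WPerfOf (sfStep Lc) (smStep 3 Lc) Wt m) (Lc ^ m) Cw'' δW' :=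
    fun m hm => by
    rcases Nat.eq_or_lt_of_le hm with h1 | h2
    · refine ⟨Cw, δW, hδW, ?_⟩
      rw [← h1, pow_one]
      exact hWinf1
    · exact hWinf m h2
  exact fPerf_succ_of_fubini_flip_holdsK S Wt hLc2 hSinf' hWinf'
    (wardTransversal_flipK_TPerfOf_one_holdsK hLc cE cVH cΛ W Cw' δw hδw hW' S Wt hLc2 hS1 hW1 hS hSall hW hWall hδS hδW hθS0 hθS1 hθW0 hθW1 hWj)
    (axisReflectionCovariant_flipK_TPerfOf_one_holdsK hLc cE cVH cΛ W Cw' δw hδw hW' S Wt hLc2 hS1 hW1 hS hSall hW hWall hδS hδW hθS0 hθS1 hθW0 hθW1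
      hRj)
    hDA hfub μ ν hSDF

/-! ## §5 The road's END and the cell's END with `hstep` FED — K-side unconditional -/

/-- **ROAD «FP», THE END FROM THE WALL's ROWS (bounded-defect form)** (`d = 3`, `2 ≤ Lc`, adopted units): `RoadFromSlots.d1Drift_JsBalOf_of_slots_step_law_bounded`
with its `hstep` FED by §4.  HYPOTHESES (all displayed, none instantiated at a value): S- and W-slot Cauchy rows + `m = 1` pins; `hRj`/`hWj`; class data of the
perfect stencils / tables for `m ≥ 2`; Fubini∞ `hfub` + `hDA`; (SDF)∞ `hSDF`; leading-log asymptotics `hasym` with bounded defect ⊢ `D1Drift Lc (JsBalOf …) N μ ν`.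
NOT «D1 closed»: `hRj`/`hWj` are two of the four binders of `d1Drift_of_D1Tel_D1Rep`, N2a/N2b/N7 are open leaves, the slots are row G-an2-4. [our object] -/
theorem d1Drift_JsBalOf_of_rows_bounded (hLc2 : 2 ≤ Lc)
    (hS1 : ∀ j, S j 1 = (JsBal0Of hLc cE cVH cΛ W Cw' δw hδw hW' j).S) (hW1 : ∀ j, Wt j 1 = W j)
    (hS : ∀ j, LocStencil (unitS (sfStep Lc j) (smStep 3 Lc j) (JsBal0Of hLc cE cVH cΛ W Cw' δw hδw hW' j).S) Cs δS)
    (hSall : ∀ k j, LocStencil (unitS (sfStep Lc (k + j)) (smStep 3 Lc (k + j)) (JsBal0Of hLc cE cVH cΛ W Cw' δw hδw hW' (k + j)).S -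
      unitS (sfStep Lc k) (smStep 3 Lc k) (JsBal0Of hLc cE cVH cΛ W Cw' δw hδw hW' k).S) (cS * θS ^ k) δS)
    (hW : ∀ j, VertexFamily₂ (unitW (sfStep Lc j) (smStep 3 Lc j) (W j)) Lc Cw δW)
    (hWall : ∀ k j, VertexFamily₂ (unitW (sfStep Lc (k + j)) (smStep 3 Lc (k + j)) (W (k + j)) - unitW (sfStep Lc k) (smStep 3 Lc k) (W k)) Lc
      (cW * θW ^ k) δW)
    (hδS : 0 < δS) (hδW : 0 < δW) (hθS0 : 0 ≤ θS) (hθS1 : θS < 1) (hθW0 : 0 ≤ θW) (hθW1 : θW < 1)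
    (hRj : ∀ j, AxisReflectionCovariant (flipK (TbalOf Lc (JsBalOf hLc cE cVH cΛ W Cw' δw hδw hW') j)))
    (hWj : ∀ j, WardTransversal (flipK (TbalOf Lc (JsBalOf hLc cE cVH cΛ W Cw' δw hδw hW') j)))
    (hSinf : ∀ m : ℕ, 2 ≤ m → ∃ Cs' δS' : ℝ, 0 < δS' ∧ LocStencil (SPerfOf (sfStep Lc) (smStep 3 Lc) S m) Cs' δS')
    (hWinf : ∀ m : ℕ, 2 ≤ m → ∃ Cw'' δW' : ℝ, 0 < δW' ∧ VertexFamily₂ (WPerfOf (sfStep Lc) (smStep 3 Lc) Wt m) (Lc ^ m) Cw'' δW')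
    (hDA : ∀ m : ℕ, 1 ≤ m → ∀ a b, AbsMoment₂ (D m a b))
    (hfub : ∀ m : ℕ, 1 ≤ m → ∀ (a b : Fin 4) (z : Fin 4 → ℤ),
      TPerfOf (Lc ^ (m + 1)) (KPerf Lc (sfStep Lc) (smStep 3 Lc) (m + 1)) (SPerfOf (sfStep Lc) (smStep 3 Lc) S (m + 1))
          (WPerfOf (sfStep Lc) (smStep 3 Lc) Wt (m + 1)) a b z
        = ((Lc ^ m : ℕ) : ℝ) ^ 8 * dressedEntry (colOf (KPerf (d := 3) Lc (sfStep Lc) (smStep 3 Lc) m))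
            (TPerfOf Lc (KPerf Lc (sfStep Lc) (smStep 3 Lc) 1) (SPerfOf (sfStep Lc) (smStep 3 Lc) S 1) (WPerfOf (sfStep Lc) (smStep 3 Lc) Wt 1))
            (((Lc ^ m : ℕ) : ℤ) • z) a b
          + TPerfOf (Lc ^ m) (KPerf Lc (sfStep Lc) (smStep 3 Lc) m) (SPerfOf (sfStep Lc) (smStep 3 Lc) S m) (WPerfOf (sfStep Lc) (smStep 3 Lc) Wt m) a b z
          + D m a b z)
    (μ ν : Fin 4) (hSDF : ∀ m : ℕ, 1 ≤ m → secondMoment (D m) μ ν = 0) {N Cg : ℝ}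
    (hasym : ∀ m : ℕ, 1 ≤ m → |fPerf Lc (sfStep Lc) (smStep 3 Lc) S Wt μ ν m - (m : ℝ) * stepBal N Lc| ≤ Cg) :
    D1Drift Lc (JsBalOf hLc cE cVH cΛ W Cw' δw hδw hW') N μ ν :=
  d1Drift_JsBalOf_of_slots_step_law_bounded hLc cE cVH cΛ W Cw' δw hδw hW' S Wt hLc2 hS1 hW1 hS hSall hW hWall hδS hδW hθS0 hθS1 hθW0 hθW1 μ ν
    (fPerf_succ_of_rows_holdsK hLc cE cVH cΛ W Cw' δw hδw hW' S Wt hLc2 hS1 hW1 hS hSall hW hWall hδS hδW hθS0 hθS1 hθW0 hθW1 hRj hWj hSinf hWinf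
      hDA hfub μ ν hSDF)
    hasym

/-- **ROAD «FP», THE END FROM THE WALL's ROWS (mean-law form)**: as above with the asymptotic input weakened to `(fPerf m − m·stepBal N Lc)/m → 0`. [our object] -/
theorem d1Drift_JsBalOf_of_rows_littleO (hLc2 : 2 ≤ Lc)
    (hS1 : ∀ j, S j 1 = (JsBal0Of hLc cE cVH cΛ W Cw' δw hδw hW' j).S) (hW1 : ∀ j, Wt j 1 = W j)
    (hS : ∀ j, LocStencil (unitS (sfStep Lc j) (smStep 3 Lc j) (JsBal0Of hLc cE cVH cΛ W Cw' δw hδw hW' j).S) Cs δS)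
    (hSall : ∀ k j, LocStencil (unitS (sfStep Lc (k + j)) (smStep 3 Lc (k + j)) (JsBal0Of hLc cE cVH cΛ W Cw' δw hδw hW' (k + j)).S -
      unitS (sfStep Lc k) (smStep 3 Lc k) (JsBal0Of hLc cE cVH cΛ W Cw' δw hδw hW' k).S) (cS * θS ^ k) δS)
    (hW : ∀ j, VertexFamily₂ (unitW (sfStep Lc j) (smStep 3 Lc j) (W j)) Lc Cw δW)
    (hWall : ∀ k j, VertexFamily₂ (unitW (sfStep Lc (k + j)) (smStep 3 Lc (k + j)) (W (k + j)) - unitW (sfStep Lc k) (smStep 3 Lc k) (W k)) Lc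
      (cW * θW ^ k) δW)
    (hδS : 0 < δS) (hδW : 0 < δW) (hθS0 : 0 ≤ θS) (hθS1 : θS < 1) (hθW0 : 0 ≤ θW) (hθW1 : θW < 1)
    (hRj : ∀ j, AxisReflectionCovariant (flipK (TbalOf Lc (JsBalOf hLc cE cVH cΛ W Cw' δw hδw hW') j)))
    (hWj : ∀ j, WardTransversal (flipK (TbalOf Lc (JsBalOf hLc cE cVH cΛ W Cw' δw hδw hW') j)))
    (hSinf : ∀ m : ℕ, 2 ≤ m → ∃ Cs' δS' : ℝ, 0 < δS' ∧ LocStencil (SPerfOf (sfStep Lc) (smStep 3 Lc) S m) Cs' δS')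
    (hWinf : ∀ m : ℕ, 2 ≤ m → ∃ Cw'' δW' : ℝ, 0 < δW' ∧ VertexFamily₂ (WPerfOf (sfStep Lc) (smStep 3 Lc) Wt m) (Lc ^ m) Cw'' δW')
    (hDA : ∀ m : ℕ, 1 ≤ m → ∀ a b, AbsMoment₂ (D m a b))
    (hfub : ∀ m : ℕ, 1 ≤ m → ∀ (a b : Fin 4) (z : Fin 4 → ℤ),
      TPerfOf (Lc ^ (m + 1)) (KPerf Lc (sfStep Lc) (smStep 3 Lc) (m + 1)) (SPerfOf (sfStep Lc) (smStep 3 Lc) S (m + 1))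
          (WPerfOf (sfStep Lc) (smStep 3 Lc) Wt (m + 1)) a b z
        = ((Lc ^ m : ℕ) : ℝ) ^ 8 * dressedEntry (colOf (KPerf (d := 3) Lc (sfStep Lc) (smStep 3 Lc) m))
            (TPerfOf Lc (KPerf Lc (sfStep Lc) (smStep 3 Lc) 1) (SPerfOf (sfStep Lc) (smStep 3 Lc) S 1) (WPerfOf (sfStep Lc) (smStep 3 Lc) Wt 1))
            (((Lc ^ m : ℕ) : ℤ) • z) a b
          + TPerfOf (Lc ^ m) (KPerf Lc (sfStep Lc) (smStep 3 Lc) m) (SPerfOf (sfStep Lc) (smStep 3 Lc) S m) (WPerfOf (sfStep Lc) (smStep 3 Lc) Wt m) a b z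
          + D m a b z)
    (μ ν : Fin 4) (hSDF : ∀ m : ℕ, 1 ≤ m → secondMoment (D m) μ ν = 0) {N : ℝ}
    (hasym : Tendsto (fun m : ℕ => (fPerf Lc (sfStep Lc) (smStep 3 Lc) S Wt μ ν m - (m : ℝ) * stepBal N Lc) / (m : ℝ)) atTop (𝓝 0)) :
    D1Drift Lc (JsBalOf hLc cE cVH cΛ W Cw' δw hδw hW') N μ ν :=
  d1Drift_JsBalOf_of_slots_step_law_littleO hLc cE cVH cΛ W Cw' δw hδw hW' S Wt hLc2 hS1 hW1 hS hSall hW hWall hδS hδW hθS0 hθS1 hθW0 hθW1 μ ν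
    (fPerf_succ_of_rows_holdsK hLc cE cVH cΛ W Cw' δw hδw hW' S Wt hLc2 hS1 hW1 hS hSall hW hWall hδS hδW hθS0 hθS1 hθW0 hθW1 hRj hWj hSinf hWinf
      hDA hfub μ ν hSDF)
    hasym

/-- **THE CELL's END STATEMENT FROM ROAD «FP» AND THE WALL's ROWS, K-SIDE UNCONDITIONAL**: `EndpointExistence Cn` BY TYPE from the S- and W-slot rows, the pins,
`hRj`/`hWj`, class data (`m ≥ 2`), Fubini∞, (SDF)∞, bounded-defect asymptotics, `hβ` (the one-loop split is the wall family's second moment), (D4) `RemainderConst`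
with `rr ≤ stepBal`, (C), `hgen` — `RoadFromSlots.endpointExistence_of_slots_step_law_bounded` BY NAME with `hstep` FED.  NOT the continuum limit's
construction: every analytic input named above is a HYPOTHESIS. [our object] -/
theorem endpointExistence_of_rows_bounded (hLc2 : 2 ≤ Lc)
    (hS1 : ∀ j, S j 1 = (JsBal0Of hLc cE cVH cΛ W Cw' δw hδw hW' j).S) (hW1 : ∀ j, Wt j 1 = W j)
    (hS : ∀ j, LocStencil (unitS (sfStep Lc j) (smStep 3 Lc j) (JsBal0Of hLc cE cVH cΛ W Cw' δw hδw hW' j).S) Cs δS)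
    (hSall : ∀ k j, LocStencil (unitS (sfStep Lc (k + j)) (smStep 3 Lc (k + j)) (JsBal0Of hLc cE cVH cΛ W Cw' δw hδw hW' (k + j)).S -
      unitS (sfStep Lc k) (smStep 3 Lc k) (JsBal0Of hLc cE cVH cΛ W Cw' δw hδw hW' k).S) (cS * θS ^ k) δS)
    (hW : ∀ j, VertexFamily₂ (unitW (sfStep Lc j) (smStep 3 Lc j) (W j)) Lc Cw δW)
    (hWall : ∀ k j, VertexFamily₂ (unitW (sfStep Lc (k + j)) (smStep 3 Lc (k + j)) (W (k + j)) - unitW (sfStep Lc k) (smStep 3 Lc k) (W k)) Lc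
      (cW * θW ^ k) δW)
    (hδS : 0 < δS) (hδW : 0 < δW) (hθS0 : 0 ≤ θS) (hθS1 : θS < 1) (hθW0 : 0 ≤ θW) (hθW1 : θW < 1)
    (hRj : ∀ j, AxisReflectionCovariant (flipK (TbalOf Lc (JsBalOf hLc cE cVH cΛ W Cw' δw hδw hW') j)))
    (hWj : ∀ j, WardTransversal (flipK (TbalOf Lc (JsBalOf hLc cE cVH cΛ W Cw' δw hδw hW') j)))
    (hSinf : ∀ m : ℕ, 2 ≤ m → ∃ Cs' δS' : ℝ, 0 < δS' ∧ LocStencil (SPerfOf (sfStep Lc) (smStep 3 Lc) S m) Cs' δS')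
    (hWinf : ∀ m : ℕ, 2 ≤ m → ∃ Cw'' δW' : ℝ, 0 < δW' ∧ VertexFamily₂ (WPerfOf (sfStep Lc) (smStep 3 Lc) Wt m) (Lc ^ m) Cw'' δW')
    (hDA : ∀ m : ℕ, 1 ≤ m → ∀ a b, AbsMoment₂ (D m a b))
    (hfub : ∀ m : ℕ, 1 ≤ m → ∀ (a b : Fin 4) (z : Fin 4 → ℤ),
      TPerfOf (Lc ^ (m + 1)) (KPerf Lc (sfStep Lc) (smStep 3 Lc) (m + 1)) (SPerfOf (sfStep Lc) (smStep 3 Lc) S (m + 1))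
          (WPerfOf (sfStep Lc) (smStep 3 Lc) Wt (m + 1)) a b z
        = ((Lc ^ m : ℕ) : ℝ) ^ 8 * dressedEntry (colOf (KPerf (d := 3) Lc (sfStep Lc) (smStep 3 Lc) m))
            (TPerfOf Lc (KPerf Lc (sfStep Lc) (smStep 3 Lc) 1) (SPerfOf (sfStep Lc) (smStep 3 Lc) S 1) (WPerfOf (sfStep Lc) (smStep 3 Lc) Wt 1))
            (((Lc ^ m : ℕ) : ℤ) • z) a b
          + TPerfOf (Lc ^ m) (KPerf Lc (sfStep Lc) (smStep 3 Lc) m) (SPerfOf (sfStep Lc) (smStep 3 Lc) S m) (WPerfOf (sfStep Lc) (smStep 3 Lc) Wt m) a b z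
          + D m a b z)
    (μ ν : Fin 4) (hSDF : ∀ m : ℕ, 1 ≤ m → secondMoment (D m) μ ν = 0) {N Cg : ℝ}
    (hasym : ∀ m : ℕ, 1 ≤ m → |fPerf Lc (sfStep Lc) (smStep 3 Lc) S Wt μ ν m - (m : ℝ) * stepBal N Lc| ≤ Cg)
    {β : HBeta} {Cn : B12.Construction} (hgen : ForwardGenerated Cn β) (Sβ : B12Beta.OneLoopSplit β)
    (hβ : ∀ j, Sβ.β0 j = B12Beta.secondMoment (TbalOf Lc (JsBalOf hLc cE cVH cΛ W Cw' δw hδw hW') j) μ ν)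
    {rr γ₀ : ℝ} (hγ₀ : 0 < γ₀) (hrem : RemainderConst Sβ γ₀ rr) (hr : rr ≤ stepBal N Lc) (hcont : BetaContH γ₀ β) :
    EndpointExistence Cn :=
  endpointExistence_of_slots_step_law_bounded hLc cE cVH cΛ W Cw' δw hδw hW' S Wt hLc2 hS1 hW1 hS hSall hW hWall hδS hδW hθS0 hθS1 hθW0 hθW1 μ ν
    (fPerf_succ_of_rows_holdsK hLc cE cVH cΛ W Cw' δw hδw hW' S Wt hLc2 hS1 hW1 hS hSall hW hWall hδS hδW hθS0 hθS1 hθW0 hθW1 hRj hWj hSinf hWinf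
      hDA hfub μ ν hSDF)
    hasym hgen Sβ hβ hγ₀ hrem hr hcont

end Rows

end

end Summit.QuantumFields.BalabanUV.Beta.FP.StepLawKHolds
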